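import Summits.ResolutionOfSingularities.ResolutionOfSingularities.Theses.MaxContactCut
import Summits.ResolutionOfSingularities.ResolutionOfSingularities.Theorems.FrobeniusDescentClasses
import Summits.ResolutionOfSingularities.ResolutionOfSingularities.Theorems.MaxContactCutTightDefect

/-!
# MaxContactCutFrobeniusDescent — the g12 node «FrobeniusDescent» wired to the route MaxContactCut BY NAME
(decomp-res node N56, lens-5 g12 sha256 12c53440862c1039; CRITIC-LEDGER row 71 CLEARED AS STRUCTURE NODE; phase 4 of 4)

Engine and blocker-first docstring: `Theorems/FrobeniusDescentAlgebra` (§1), `FrobeniusDescentStates` (§2: `frobState`,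
`step_frobState`, `isolatedTop_pow_char_iff`, `liftWalk` / `descendWalk`, `Primitive`), `FrobeniusDescentClasses` (§§3–4:
the column pieces and the PROVED carve).  Route asides (MaxContactCut, `aside · rank 9`): `PrimDefectWalksDeep` [THE
RE-LOCATED FAITHFUL DEEP RESIDUAL — REDUCED heads, `e ≥ 2`; UNDECIDED · IDEA-NEEDED · 0], `DefectWalksOne` [the `e = 1`
model column, KNOWN-MOD-PORT: Cossart–Piltant 2019 Thm 1.5 (i) via `ShallowColumnPort` + `ShallowRealisation`],
`PrimWalks` [primitive heads, all `e`; ⟺ `WalksTerminate`], refining `DefectWalksDeep` 31770 and `PolyPureTowersDeep` 31769.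

Kernels (all by name, 0 sorry; the aside-level `Iff.rfl` unfoldings and re-keyings are the companion file
`MaxContactCutFrobeniusDescentAsides`, filed once the asides exist on the route): **31770 ⟺ `PrimDefectWalksDeep
∧ DefectWalksOne`** (EXACT,
`defectWalksDeep_iff_prim_and_one`); the MODEL-FIDELITY finding **31770 ⟺ `WalksTerminate` ⟺ `PrimWalks`**
(`defectWalksDeep_iff_walksTerminate`, `defectWalksDeep_iff_primWalks`); 31770 ⟸ `PrimDefectWalksDeep` modulo
`CossartPiltant2019LocalPermissible` + the two ports (`defectWalksDeep_of_prim_cp`); necessity from 30253 modulo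
`TowerRealisation` (`pieces_of_noForcedTowers`); the polynomial pure-head slice from the residual
(`polyPureTowersTerminate_of_prim_cp`).  ROOT BY NAME is the host's `MaxContactCutExponentLadder.closes` (this node is an
aside ladder under 31770 / 30253; the cone is unchanged — not restated here).  (Sources: HauserPerlega2024 pp. 20, 24;
Hauser2010 §F; CossartPiltant2019 Thm 1.5; Hartshorne1977 II.7.16.)
-/

noncomputable section

namespace Summit.ResolutionOfSingularities.ResolutionOfSingularities.Theorems.MaxContactCutFrobeniusDescent

open MvPolynomial
open Literature.AlgebraicGeometry.Resolution
open Summit.ResolutionOfSingularities.ResolutionOfSingularities.Theses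
open Summit.ResolutionOfSingularities.ResolutionOfSingularities.Theorems
open TightDefectClasses TightDefectStrongWalks FrobeniusDescentStates FrobeniusDescentClasses

/-! ## Wiring BY NAME to 31770 `DefectWalksDeep`, 31769 / 30253 (the lens §5) -/

/-- **31770 ⟺ primitive deep residual ∧ `e = 1` model column** (EXACT). [folklore] -/
theorem defectWalksDeep_iff_prim_and_one :
    MaxContactCut.DefectWalksDeep ↔ PrimDefectWalksTerminateDeep ∧ DefectWalksTerminateOne :=
  MaxContactCutTightDefect.defectWalksDeep_iff.trans defectDeep_iff_prim_and_one

/-- **31770 ⟺ `WalksTerminate`** (the `e`-axis collapses in the model). [folklore] -/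
theorem defectWalksDeep_iff_walksTerminate : MaxContactCut.DefectWalksDeep ↔ WalksTerminate :=
  MaxContactCutTightDefect.defectWalksDeep_iff.trans defectDeep_iff_walks

/-- **31770 ⟺ `PrimWalksTerminate`** (primitive heads, all `e`). [folklore] -/
theorem defectWalksDeep_iff_primWalks : MaxContactCut.DefectWalksDeep ↔ PrimWalksTerminate :=
  defectWalksDeep_iff_walksTerminate.trans walksTerminate_iff_prim

/-- **31770 ⟸ the primitive deep residual, modulo CP2019 Thm 1.5 (i) and the two ports.** [folklore] -/
theorem defectWalksDeep_of_prim_cp (hCP : Literature.AlgebraicGeometry.Resolution.CossartPiltant2019LocalPermissible.{0})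
    (hV : ShallowColumnPort) (hR : ShallowRealisation) (hP : PrimDefectWalksTerminateDeep) : MaxContactCut.DefectWalksDeep :=
  MaxContactCutTightDefect.defectWalksDeep_iff.mpr (defectDeep_of_prim_cp hCP hV hR hP)

/-- **NECESSITY from 30253 `NoForcedTowers`** (mod the tree's realisation port): every piece of this node. [folklore] -/
theorem pieces_of_noForcedTowers (hR : TowerRealisation) (h : MaxContactCut.NoForcedTowers) :
    PrimWalksTerminate ∧ PrimDefectWalksTerminateDeep ∧ DefectWalksTerminateOne :=
  have hW : WalksTerminate := (MaxContactCutTightDefect.pieces_of_noForcedTowers hR h).2.1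
  have hD : DefectWalksTerminateDeep := defectDeep_iff_walks.mpr hW
  ⟨walksTerminate_iff_prim.mp hW, primDefectDeep_of_defectDeep hD, defectOne_of_defectDeep hD⟩

/-- **The polynomial pure-head SLICE from the primitive deep residual** (dictionary port + CP column + ports). [folklore] -/
theorem polyPureTowersTerminate_of_prim_cp
    (hCP : Literature.AlgebraicGeometry.Resolution.CossartPiltant2019LocalPermissible.{0}) (hV : ShallowColumnPort)
    (hR : ShallowRealisation) (hT : TowerDictionary) (hP : PrimDefectWalksTerminateDeep) : PolyPureTowersTerminate :=
  MaxContactCutTightDefect.polyPureTowersTerminate_of_cp hCP hV hT (defectWalksDeep_of_prim_cp hCP hV hR hP)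
end Summit.ResolutionOfSingularities.ResolutionOfSingularities.Theorems.MaxContactCutFrobeniusDescent
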